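import Summits.NavierStokesRegularity.FluidComputer.PalasekTowerGermHost
import Summits.NavierStokesRegularity.FluidComputer.PalasekTowerRegisterGlobalDesignSlot

/-!
# The germ host, IV: every host of the germ schedule reads `U` with velocity `V` — the design classes it fills

Cell `ns-blowup`, seat `ns-blowup-ecbridge-3` (g3); GROUP C «BRIDGE SUPPORT» of the route
`PalasekTowerBreakdown` (crux `EpisodeBaseG`, item stmt-NavierStokesRegularity-19179, R2 of record).
LABEL: E–C typing (KERNEL: one definition with body — the rising rate of a profile in the slot — and
theorems). WHAT THIS IS NOT: not Navier–Stokes evidence — statements about the PRESCRIBED level-`0`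
host of `PalasekTowerGermHost`; nothing about NS dynamics after `τ₀`, `RungG 1` or blow-up.

## What and why

`PalasekTowerGermHost` (p443639) proves `HostPreparationD (HostClass.exact (h.schedule c₄ …))` for every
profile `U` in the slot `LevelZeroData U ρ`. The filing shape of record for a NAMED design (seat
ecbridge-4, `PalasekTowerRegisterGlobalDesignSlot`, p419455) is a class
`GoodHost := (HostClass.nearC1 𝒰 ε₀ ε₁).inter (HostClass.rising κ)`: readout state `C¹`-close to a
profile family, squared speed RISING into `τ₀` at rate `≥ κ` at every floor point. This file shows the
germ host fills that shape with ZERO tolerance and a POSITIVE rate: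

* §1 every registered level-`0` stage `s₀` of the germ schedule (ANY margin) has velocity `= the germ`
  on `[0, τ₀]` (`stage_u_eq`: a stage pins the design's flow — forced Serrin–Masuda, no W14,
  `Stage.velocity_eq_of_classical`), so `s₀.u (τ 0) = U` and `∂ₜ s₀.u (τ₀⁻) = V = P(ΔU − (U·∇)U)`;
* §2 the singleton class of the germ schedule lies inside `nearC1 {U} 0 0` and inside `rising κ` for
  every `κ` below the anchor test values `⟪U, V⟫` on the argmax; by compactness these have a POSITIVE
  minimum `h.rate` (`exists_rate`);
* §3 **`hostPreparationD_goodHost`**: `HostPreparationD ((exact S) ⊓ (nearC1 {U} 0 0 ⊓ rising h.rate))`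
  with `0 < h.rate` — in contrast with the quasi-static Host series of record, whose rising rate is
  EXACTLY `0` (`Host.rising_iff`, `Host.not_hostPreparationD_exact_inter_rising`, p434867): the germ host
  is read while its maximum speed is genuinely growing, at the rate the strict anchor test measures.

References: S. Palasek, arXiv:2605.13827 §3.3 (host preparation before the first readout)
[cite: Palasek2026ElementaryModel, §3.3]; H. Sohr, *The Navier–Stokes Equations* (Birkhäuser 2001),
Ch. V Thm. 1.5.1 (forced Serrin–Masuda weak–strong uniqueness) [cite: Sohr2001, Ch. V Thm. 1.5.1].
-/

noncomputable section

namespace Summit.NavierStokesRegularity.FluidComputer.PalasekTowerClayBridge.Germ.LevelZeroData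

open Set Function Filter Topology InnerProductSpace Metric MeasureTheory
open scoped Topology ContDiff RealInnerProductSpace ENNReal

open Literature.Analysis.FluidPDE

variable {U : EuclideanSpace ℝ (Fin 3) → EuclideanSpace ℝ (Fin 3)} {ρ : ℝ} (h : LevelZeroData U ρ)
  {c₄ : ℝ} (hc₄ : 0 < c₄) (hc₄' : c₄ ≤ 1)
include h

/-! ## §1 Every host of the germ schedule IS the germ on the slab -/

/-- **A registered level-`0` stage of the germ schedule has the germ's velocity on `[0, 1]`** (any
margin): the stage pins the design's classical finite-energy flow (`Stage.velocity_eq_of_classical`,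
forced Serrin–Masuda — no W14). [cite: Sohr2001, Ch. V Thm. 1.5.1] -/
theorem stage_u_eq {m : Margins TowerRates.wide}
    (s₀ : Stage 1 TowerRates.wide (h.schedule c₄ hc₄ hc₄') m 0) :
    ∀ t ∈ Icc (0 : ℝ) 1, s₀.u t = h.vel t := by
  have hτ0 : (h.schedule c₄ hc₄ hc₄').τ 0 = 1 := h.schedule_τ_zero hc₄ hc₄'
  have hcl : IsClassicalNSSolutionOn (Icc 0 1) 1 (h.schedule c₄ hc₄ hc₄').f h.vel h.pres :=
    h.isClassicalNSSolutionOn_vel hc₄ hc₄'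
  have h0 : h.vel 0 = (h.schedule c₄ hc₄ hc₄').u₀ := by rw [h.vel_zero]; rfl
  have key := s₀.velocity_eq_of_classical one_pos (T' := 1) (by rw [hτ0]) hcl h0 h.energy_vel
  intro t ht
  rw [hτ0] at key
  exact (key t ht).symm

/-- **`u(τ₀) = U` for every host of the germ schedule.** [cite: Sohr2001, Ch. V Thm. 1.5.1] -/
theorem stage_u_τ_zero {m : Margins TowerRates.wide}
    (s₀ : Stage 1 TowerRates.wide (h.schedule c₄ hc₄ hc₄') m 0) :
    s₀.u ((h.schedule c₄ hc₄ hc₄').τ 0) = U := by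
  rw [h.schedule_τ_zero hc₄ hc₄', h.stage_u_eq hc₄ hc₄' s₀ 1 ⟨zero_le_one, le_rfl⟩, h.vel_one]

/-- **`∂ₜu(τ₀⁻) = V` for every host of the germ schedule** (one-sided derivative within the slab).
[cite: Sohr2001, Ch. V Thm. 1.5.1] -/
theorem timeDerivWithin_stage_τ_zero {m : Margins TowerRates.wide}
    (s₀ : Stage 1 TowerRates.wide (h.schedule c₄ hc₄ hc₄') m 0) (x : EuclideanSpace ℝ (Fin 3)) :
    timeDerivWithin (Icc 0 ((h.schedule c₄ hc₄ hc₄').τ 0)) s₀.u ((h.schedule c₄ hc₄ hc₄').τ 0) x =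
      accel 1 U x := by
  rw [h.schedule_τ_zero hc₄ hc₄', ← h.timeDerivWithin_vel_one x, timeDerivWithin_apply,
    timeDerivWithin_apply]
  refine derivWithin_congr (fun s hs => ?_) ?_
  · rw [h.stage_u_eq hc₄ hc₄' s₀ s hs]
  · rw [h.stage_u_eq hc₄ hc₄' s₀ 1 ⟨zero_le_one, le_rfl⟩]

/-- At a floor point of a host of the germ schedule the profile attains exactly `Y₀`. [folklore] -/
theorem norm_eq_of_floor {m : Margins TowerRates.wide}
    (s₀ : Stage 1 TowerRates.wide (h.schedule c₄ hc₄ hc₄') m 0) {x₀ : EuclideanSpace ℝ (Fin 3)}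
    (hfl : (h.schedule c₄ hc₄ hc₄').c₁ * TowerRates.wide.Y 0 ≤
      ‖s₀.u ((h.schedule c₄ hc₄ hc₄').τ 0) x₀‖) :
    ‖U x₀‖ = TowerRates.wide.Y 0 := by
  rw [h.stage_u_τ_zero hc₄ hc₄' s₀, schedule_c₁, one_mul] at hfl
  exact le_antisymm (h.ceiling x₀) hfl

/-! ## §2 The design classes containing the singleton class of the germ schedule -/

/-- **Zero tolerance**: every host of the germ schedule reads EXACTLY the named profile —
`HostClass.exact S ≤ HostClass.nearC1 {U} 0 0`. [folklore] -/
theorem exact_le_nearC1 : ∀ S' s₀, HostClass.exact (h.schedule c₄ hc₄ hc₄') S' s₀ →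
    HostClass.nearC1 {U} 0 0 S' s₀ := by
  intro S' s₀ hS'
  have hS : S' = h.schedule c₄ hc₄ hc₄' := hS'
  subst hS
  have hu : s₀.u ((h.schedule c₄ hc₄ hc₄').τ 0) = U := h.stage_u_τ_zero hc₄ hc₄' s₀
  refine ⟨U, mem_singleton U, fun x => ?_, fun x => ?_⟩
  · rw [hu, sub_self, norm_zero]
  · rw [hu, sub_self, norm_zero]

/-- **Rising at every rate below the anchor test values**: if `κ ≤ ⟪U(x₀), V(x₀)⟫` at every point with
`‖U(x₀)‖ = Y₀`, then `HostClass.exact S ≤ HostClass.rising κ`. [folklore] -/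
theorem exact_le_rising {κ : ℝ}
    (hκ : ∀ x₀, ‖U x₀‖ = TowerRates.wide.Y 0 → κ ≤ ⟪U x₀, accel 1 U x₀⟫) :
    ∀ S' s₀, HostClass.exact (h.schedule c₄ hc₄ hc₄') S' s₀ → HostClass.rising κ S' s₀ := by
  intro S' s₀ hS'
  have hS : S' = h.schedule c₄ hc₄ hc₄' := hS'
  subst hS
  intro x₀ _ hfl
  have hx₀ : ‖U x₀‖ = TowerRates.wide.Y 0 := h.norm_eq_of_floor hc₄ hc₄' s₀ hfl
  rw [h.timeDerivWithin_stage_τ_zero hc₄ hc₄' s₀ x₀, h.stage_u_τ_zero hc₄ hc₄' s₀]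
  exact hκ x₀ hx₀

/-- **The anchor test values have a positive minimum on the argmax** (the argmax of `‖U‖` is a compact
subset of the support, on which `⟪U, V⟫` is continuous and positive). [folklore] -/
theorem exists_rate : ∃ κ : ℝ, 0 < κ ∧
    ∀ x₀, ‖U x₀‖ = TowerRates.wide.Y 0 → κ ≤ ⟪U x₀, accel 1 U x₀⟫ := by
  have hY := Host.wide_Y_zero_pos
  set g : EuclideanSpace ℝ (Fin 3) → ℝ := fun x => ⟪U x, accel 1 U x⟫ with hg
  have hgc : Continuous g :=
    h.smooth.continuous.inner (contDiff_accel h.smooth h.hasCompactSupport 1).continuous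
  set M := tsupport U ∩ {x | TowerRates.wide.Y 0 ≤ ‖U x‖} with hM
  have hMc : IsCompact M :=
    h.hasCompactSupport.inter_right (isClosed_le continuous_const h.smooth.continuous.norm)
  have hpos : ∀ x ∈ M, 0 < g x := by
    intro x hx
    exact h.anchor x (le_antisymm (h.ceiling x) hx.2)
  obtain ⟨κ, hκ, hκM⟩ := hMc.exists_forall_le' (f := g) hgc.continuousOn hpos
  refine ⟨κ, hκ, fun x₀ hx₀ => hκM x₀ ⟨?_, ?_⟩⟩
  · refine subset_tsupport _ (mem_support.2 fun h0 => ?_)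
    rw [h0, norm_zero] at hx₀
    linarith
  · exact hx₀.ge

/-- **The rising rate of the profile** (a choice of the positive minimum above). [folklore] -/
def rate : ℝ := h.exists_rate.choose

/-- `0 < rate`. [folklore] -/
theorem rate_pos : 0 < h.rate := h.exists_rate.choose_spec.1

/-- `rate ≤ ⟪U, V⟫` on the argmax. [folklore] -/
theorem rate_le {x₀ : EuclideanSpace ℝ (Fin 3)} (hx₀ : ‖U x₀‖ = TowerRates.wide.Y 0) :
    h.rate ≤ ⟪U x₀, accel 1 U x₀⟫ :=
  h.exists_rate.choose_spec.2 x₀ hx₀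

/-! ## §3 The germ host fills the `GoodHost` shape with zero tolerance and positive rate -/

/-- **HOST PREPARATION IN THE `GoodHost` SHAPE OF RECORD**: the singleton class of the germ schedule,
cut down to `nearC1 {U} 0 0 ⊓ rising rate` with `0 < rate`, is prepared — by the germ host itself
(every host of the schedule lies in both classes). [cite: Palasek2026ElementaryModel, §3.3] -/
theorem hostPreparationD_goodHost :
    HostPreparationD ((HostClass.exact (h.schedule c₄ hc₄ hc₄')).inter
      ((HostClass.nearC1 {U} 0 0).inter (HostClass.rising h.rate))) := by
  obtain ⟨S, s₀, hP, hR, hQ, hD⟩ := h.hostPreparationD_exact hc₄ hc₄'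
  exact ⟨S, s₀, hP, hR, hQ, hD, h.exact_le_nearC1 hc₄ hc₄' S s₀ hD,
    h.exact_le_rising hc₄ hc₄' (fun _ hx => h.rate_le hx) S s₀ hD⟩

/-- **Positive rising rate** (contrast: the Host series of record is NOT prepared in any `rising κ`,
`κ > 0` — `Host.not_hostPreparationD_exact_inter_rising`): the germ schedule is prepared in
`exact S ⊓ rising κ` for EVERY `κ ≤ rate`, in particular for some `κ > 0`. [folklore] -/
theorem hostPreparationD_exact_inter_rising {κ : ℝ} (hκ : κ ≤ h.rate) :
    HostPreparationD ((HostClass.exact (h.schedule c₄ hc₄ hc₄')).inter (HostClass.rising κ)) := by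
  obtain ⟨S, s₀, hP, hR, hQ, hD⟩ := h.hostPreparationD_exact hc₄ hc₄'
  exact ⟨S, s₀, hP, hR, hQ, hD,
    h.exact_le_rising hc₄ hc₄' (fun _ hx => hκ.trans (h.rate_le hx)) S s₀ hD⟩

/-- The same with the rate displayed existentially: some `κ > 0` works. [folklore] -/
theorem exists_hostPreparationD_exact_inter_rising :
    ∃ κ : ℝ, 0 < κ ∧
      HostPreparationD ((HostClass.exact (h.schedule c₄ hc₄ hc₄')).inter (HostClass.rising κ)) :=
  ⟨h.rate, h.rate_pos, h.hostPreparationD_exact_inter_rising hc₄ hc₄' le_rfl⟩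

end Summit.NavierStokesRegularity.FluidComputer.PalasekTowerClayBridge.Germ.LevelZeroData

end
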